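import Summits.QuantumFields.YangMills.Theorems.BalabanUVNodesN11TransportOfRecordInPrivateCoordinateChart

/-!
# DAG node N11 — THE INVERSE CHANGE-OF-VARIABLES LAWS OF THE PRIVATE-COORDINATE CHART FROM ABSOLUTE CONTINUITY ALONE (Radon–Nikodym for kernels):
# the `hlaw` socket of the (0.4) one-variable fibre maps of the averaging of record DISCHARGED for every `SU(N)` — no Jacobian, no exponential chart

HEADER — WORK-UNIT METADATA.  Cell `pub-ymgap`, YM-PLAN Track A (HUMAN RULING D-0062 ∕ D-0149 ∕ D-0154 (3a)), WIDTH SEAT `pub-ymgap-dag-n11-w6` (g2) on node N11 [B14];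
route `BalabanUVNodes`, key item K1⁷ `StabilityBAtRecordR13SepCoPH` = stmt-QuantumFields-20542 (helper lane, `--kind proof --supports 20542 --as helper`, count-neutral).
[I] = [Balaban1987RG1], [III] = [Balaban1988Convergent].  Bus: CLAIM-2 = INTENT-2 of this seat (R455 (A)).  Sequel of this seat's
`…N11TransportOfRecordInPrivateCoordinateChart` ((B4)'s chart half at `fieldMeasure`, private-coordinate edition: dag-n11-d's socket `hpush` ∕ `hfib` and
`transportOfRecord =ᵐ` the chart integral, MODULO per-bond inversion data `(Ω, T, ϑ, j; hΩbl, hright, hlaw)` of dag-n09-w6 g3's engine `T4TriangularFibredChart`).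

WHY THIS FILE.  On dag-n09-w6 g3's private-coordinate road (N09's `hreg`; my file 1 = its N11 reading) the per-bond bundle is produced from an INJECTIVITY WINDOW plus a
FORWARD JACOBIAN LAW `dW⌊image = ψ_*(jac · dg⌊Ω)` with a jointly measurable non-vanishing `jac` (their `…N09PerBondChartsOfInjectivityWindows` ∕ `…N09CentralWindowAtRecord`
`exists_perBondCharts_of_forwardLaws`, hypotheses `jac, hjacm, hjac0, hfwd`) — the located remainder «(F): C¹-in-exponential-chart of the (0.4) map ⇒ n09-w4's
`haar_restrict_image_eq_map_withDensity_jacobian`».  THIS FILE observes that the engine's INVERSE LAW `hlaw : dg⌊Ω_c(U) = ϑ_c(U,·)_*(j_c(U,·) · dv⌊T_c(U))` needs NO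
Jacobian: it follows from the ABSOLUTE CONTINUITY of the windowed one-variable law `(dg⌊Ω_c(U)).map (g ↦ Ū′(c))` w.r.t. one-bond Haar measure — by the Radon–Nikodym
theorem FOR KERNELS (Mathlib `ProbabilityTheory.Kernel.rnDeriv`, jointly measurable in (environment, point); `Kernel.withDensity_rnDeriv_eq`) applied to the measurable
family of windowed laws, and the left-inverse property of `ϑ` — and that this absolute continuity IS IN THE TREE for every `N ≥ 1`, every environment and every coarse
bond: it is the per-bond input of the tree's own `HaarAC` proof for the averaging of record (`BlockAveragingEMLHaarAC.map_haar_avgFun_update_absolutelyContinuous_of_guard` at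
`BlockAveragingEMLHaarACSUN.haar_restrict_fibreGuard_map_absolutelyContinuous_of_fibreLaw BlockAveragingEMLFibreLawSUN.emlFibreLaw_fin`, i.e. the exp-mean-log fibre law on
`SU(N)` from `T4EMLTangentInjective`).  So the law socket of the private-coordinate chart is DISCHARGED outright; what the road still displays is the INVERSE itself
(`T`, `ϑ` with `hright`∕`hleft` — which dag-n09-w6's `Lit/MeasureTheory/Function/MeasurableInvFunOn.exists_measurable_fibrewiseInverse` produces from an injectivity
window by Lusin–Souslin, and their `EMLFibreMapInjective` ∕ `…N09CentralWindowInjective` prove the injectivity of the (0.4) map on the central α-window) and, for N11,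
the support clause.  The density `j` obtained here is an `L¹` Radon–Nikodym version, not a continuous Jacobian: enough for every a.e. identity of the (B4) socket
(`hpush`, `hfib`, `transportOfRecord =ᵐ …`), NOT for N09's continuity clause `hgc` (which keeps wanting (F)).

WHAT THIS FILE PROVES (0 `def`, 0 `sorry`, standard axioms).
§1 (generic; `E` any measurable space of environments, `G` countably generated, finite `μ`, `ν`): `measurable_map_restrict_family` (the windowed laws
`e ↦ (μ⌊Ω(e)).map ψ(e,·)` form a measurable family — Tonelli) · ★★★ `exists_density_inverseLaw_of_absolutelyContinuous` (jointly measurable `ψ`, `Ω`, measurable coarse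
windows `T(e) ⊇ ψ(e,·)(Ω(e))`, a jointly measurable left inverse `θ(e,·)` on `Ω(e)`, and `(μ⌊Ω(e)).map ψ(e,·) ≪ ν` for all `e` ⟹ ONE jointly measurable `jd : E → G → ℝ≥0` with
`μ⌊Ω(e) = θ(e,·)_*(jd(e,·) · ν⌊T(e))` for every `e`) · `absolutelyContinuous_map_restrict_of_map` (windowing preserves absolute continuity).
§2 (at the record, `G = SU(N)`, `μ = ν =` Haar, `E = GaugeField (F.P K) k SU(N)`, `k < K`): ★ `map_haar_oneVariable_avOfRecord_absolutelyContinuous` (the one-variable law of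
`g ↦ Ū′(c)`, `U′ = U[β(c) ↦ g]`, of `avOfRecord F N K k` IS absolutely continuous — the tree's theorem, by name) · `measurable_oneVariable_avOfRecord` ·
★★★ `exists_perBondInverseLaws_of_inverses` (per-bond windows `Ω`, coarse windows `T ⊇` image, jointly measurable left inverses `ϑ` ⟹ ∃ jointly measurable `jd ≥ 0` with the
engine's `hlaw` for every `c`, `U` — the `(jd, hjm, hlaw)` third of the per-bond bundle, from `(Ω, T, ϑ; hΩm, hTm, hθm, hΩT, hleft)` ALONE).
§3 (N11 capstone over file 1): ★★★ `exists_jacobian_transportOfRecord_ae_eq_integral_privateChart` (per-bond `(Ω, T, ϑ)` with blindness `hΩbl`, right inverse `hright`, left inverse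
`hleft`, image inclusion `hΩT` — NO law, NO Jacobian among the hypotheses ⟹ ∃ jointly measurable `jd` such that dag-n11-d's `hpush` ∕ `hfib` hold at `fieldMeasure` with the
constant fibre reference AND, for every `dU`-integrable measurable `ρ` with the support clause, `transportOfRecord F N K k ρ =ᵐ[dV] V ↦ ∫ dU J(V,U)·ρ(Ψ(V,U))`).

HONEST FRAMING.  Helper lane of K1⁷; count-neutral; kernel measure theory BY NAME (Mathlib's kernel Radon–Nikodym + the tree's exp-mean-log fibre law + file 1 + p616307 + p610288).
The INVERSES `(T, ϑ; hright, hleft, hΩT)` and the windows `(Ω; hΩm, hΩbl)` remain HYPOTHESES here (dag-n09-w6 g3's in-flight files produce them from the central α-window);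
the support clause remains displayed; NO chart of Bałaban's ((47), [III] (3.10)–(3.25)) is asserted; the Jacobian obtained is a Radon–Nikodym version (no continuity claimed);
(B4) ∕ (S-α) NOT closed; N11 NOT discharged; N09's `hgc` untouched; K1⁷ ∕ K1⁸ NOT closed, no registered stub touched; counts unmoved (typed 28∕28 · discharged 5∕27 · A 5∕28).
No summit statement is proved by this seat.  One finite `𝕋⁴_{L^K}` programme at fixed `ε = L^{−K}`; R4 closes only the conditional finite-𝕋⁴ rung `BalabanLadder.UV` — NOT ℝ⁴,
NOT OS, NOT a mass gap, NOT Clay.  No `sorry`, `axiom`, `def`, `instance`, `notation`.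
Sources (SHAPE ∕ bookkeeping only): [I] (0.4) p.253, (2.4) p.266, (2.10) p.267; [III] (3.1) p.264, p.267 L18–24; Kallenberg, Random Measures, Thm 1.28 (kernel Radon–Nikodym,
Mathlib `ProbabilityTheory.Kernel.rnDeriv`) — folklore.
-/

noncomputable section

open MeasureTheory ProbabilityTheory Set Function
open scoped ENNReal NNReal

namespace Summit.QuantumFields.YangMills.Theorems.BalabanUVNodesN11PerBondInverseLawsOfRecordAC

/-! ## §1  Generic: the inverse law of a measurable family of windowed one-variable maps from absolute continuity (Radon–Nikodym for kernels) -/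

section Generic

variable {E G : Type*} [MeasurableSpace E] [MeasurableSpace G]

/-- The family of WINDOWED ONE-VARIABLE LAWS `e ↦ (μ⌊Ω(e)).map ψ(e,·)` is a measurable family of measures (a kernel) when `ψ` and the windows are jointly
measurable (Tonelli: `measurable_measure_prodMk_left` on `ψ⁻¹s ∩ {(e,g) | g ∈ Ω(e)}`). [cite: Balaban1987RG1, (0.4) p.253 (bookkeeping: measurability)] -/
theorem measurable_map_restrict_family (μ : Measure G) [SFinite μ] {ψ : E × G → G} (hψ : Measurable ψ)
    {Ω : E → Set G} (hΩ : MeasurableSet {p : E × G | p.2 ∈ Ω p.1}) :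
    Measurable fun e => (μ.restrict (Ω e)).map fun g => ψ (e, g) := by
  refine Measure.measurable_of_measurable_coe _ fun s hs => ?_
  have hψe : ∀ e, Measurable fun g => ψ (e, g) := fun e => hψ.comp measurable_prodMk_left
  have heq : (fun e => ((μ.restrict (Ω e)).map fun g => ψ (e, g)) s) =
      fun e => μ (Prod.mk e ⁻¹' ((ψ ⁻¹' s) ∩ {p : E × G | p.2 ∈ Ω p.1})) := by
    funext e
    rw [Measure.map_apply (hψe e) hs, Measure.restrict_apply ((hψe e) hs)]
    rfl
  rw [heq]
  exact measurable_measure_prodMk_left ((hψ hs).inter hΩ)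

/-- **★★★ THE INVERSE CHANGE-OF-VARIABLES LAW FROM ABSOLUTE CONTINUITY ALONE (Radon–Nikodym for kernels).**  `E` any measurable space of environments, `G` countably
generated (e.g. standard Borel), finite measures `μ` (fine one-bond reference) and `ν` (coarse one-bond reference) on `G`; a jointly measurable family `ψ : E × G → G` of
one-variable maps; jointly measurable fine windows `Ω(e)` mapped by `ψ(e,·)` into measurable coarse windows `T(e)`; a jointly measurable LEFT INVERSE `θ(e,·)` of `ψ(e,·)` on
`Ω(e)`; and every windowed law `(μ⌊Ω(e)).map ψ(e,·)` ABSOLUTELY CONTINUOUS w.r.t. `ν`.  THEN there is ONE jointly measurable density `jd : E → G → ℝ≥0` with, for every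
environment `e`, the INVERSE LAW `μ⌊Ω(e) = θ(e,·)_*(jd(e,·) · ν⌊T(e))` — the `hlaw` socket of `T4TriangularFibredChart` — with NO differentiability and NO Jacobian: `jd(e,·)` is
(the finite part of) the kernel Radon–Nikodym derivative of the windowed law against the constant kernel `ν`; the windowed law equals `jd(e,·)·ν`, is carried by `T(e)`, and
pushing it back by the left inverse recovers `μ⌊Ω(e)`. [cite: Balaban1987RG1, (2.10) p.267 (bookkeeping: the substitution's law, read measure-theoretically)] -/
theorem exists_density_inverseLaw_of_absolutelyContinuous [MeasurableSpace.CountablyGenerated G]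
    (μ ν : Measure G) [IsFiniteMeasure μ] [IsFiniteMeasure ν]
    {ψ : E × G → G} (hψ : Measurable ψ) {Ω : E → Set G} (hΩ : MeasurableSet {p : E × G | p.2 ∈ Ω p.1})
    {T : E → Set G} (hT : ∀ e, MeasurableSet (T e)) (hΩT : ∀ e, MapsTo (fun g => ψ (e, g)) (Ω e) (T e))
    {θ : E × G → G} (hθ : Measurable θ) (hleft : ∀ e, ∀ g ∈ Ω e, θ (e, ψ (e, g)) = g)
    (hac : ∀ e, ((μ.restrict (Ω e)).map fun g => ψ (e, g)) ≪ ν) :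
    ∃ jd : E → G → ℝ≥0, Measurable (fun p : E × G => jd p.1 p.2) ∧
      ∀ e, μ.restrict (Ω e) = ((ν.restrict (T e)).withDensity fun v => (jd e v : ℝ≥0∞)).map fun v => θ (e, v) := by
  classical
  have hψe : ∀ e, Measurable fun g => ψ (e, g) := fun e => hψ.comp measurable_prodMk_left
  have hθe : ∀ e, Measurable fun v => θ (e, v) := fun e => hθ.comp measurable_prodMk_left
  have hΩe : ∀ e, MeasurableSet (Ω e) := fun e => measurable_prodMk_left hΩ
  -- the kernel of windowed one-variable laws and the constant reference kernel
  let κ : Kernel E G := ⟨fun e => (μ.restrict (Ω e)).map fun g => ψ (e, g), measurable_map_restrict_family μ hψ hΩ⟩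
  have hκ : ∀ e, κ e = (μ.restrict (Ω e)).map fun g => ψ (e, g) := fun e => rfl
  haveI : IsFiniteKernel κ := by
    refine ⟨⟨μ univ, measure_lt_top _ _, fun e => ?_⟩⟩
    rw [hκ, Measure.map_apply (hψe e) MeasurableSet.univ, Measure.restrict_apply ((hψe e) MeasurableSet.univ)]
    exact measure_mono (subset_univ _)
  let η : Kernel E G := Kernel.const E ν
  have hη : ∀ e, η e = ν := fun e => Kernel.const_apply _ _
  refine ⟨fun e v => (Kernel.rnDeriv κ η e v).toNNReal, (Kernel.measurable_rnDeriv κ η).ennreal_toNNReal, fun e => ?_⟩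
  have hκη : κ e ≪ η e := by rw [hκ, hη]; exact hac e
  -- the `ℝ≥0`-valued density has the windowed law as its `ν`-indefinite integral
  have h1 : ν.withDensity (fun v => ((Kernel.rnDeriv κ η e v).toNNReal : ℝ≥0∞)) = κ e := by
    have hcongr : (fun v => ((Kernel.rnDeriv κ η e v).toNNReal : ℝ≥0∞)) =ᵐ[ν] fun v => Kernel.rnDeriv κ η e v := by
      have hfin : ∀ᵐ v ∂ν, Kernel.rnDeriv κ η e v ≠ ∞ := by
        have h := Kernel.rnDeriv_ne_top κ η (a := e)
        rwa [hη] at h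
      filter_upwards [hfin] with v hv
      exact ENNReal.coe_toNNReal hv
    rw [withDensity_congr_ae hcongr]
    have h := Kernel.withDensity_rnDeriv_eq (κ := κ) (η := η) hκη
    rwa [Kernel.withDensity_apply _ (Kernel.measurable_rnDeriv _ _), hη] at h
  -- the windowed law is carried by the coarse window
  have h2 : (ν.restrict (T e)).withDensity (fun v => ((Kernel.rnDeriv κ η e v).toNNReal : ℝ≥0∞)) = κ e := by
    rw [← restrict_withDensity (hT e), h1]
    refine Measure.restrict_eq_self_of_ae_mem ?_
    rw [hκ]
    refine (ae_map_iff (hψe e).aemeasurable (hT e)).2 ?_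
    filter_upwards [ae_restrict_mem (hΩe e)] with g hg using hΩT e hg
  rw [h2, hκ, Measure.map_map (hθe e) (hψe e)]
  symm
  calc (μ.restrict (Ω e)).map ((fun v => θ (e, v)) ∘ fun g => ψ (e, g)) = (μ.restrict (Ω e)).map id :=
        Measure.map_congr (by
          filter_upwards [ae_restrict_mem (hΩe e)] with g hg
          exact hleft e g hg)
    _ = μ.restrict (Ω e) := Measure.map_id

/-- WINDOWING PRESERVES ABSOLUTE CONTINUITY: if the full one-variable law `μ.map f` is absolutely continuous w.r.t. `ν`, so is every windowed law `(μ⌊S).map f`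
(`Measure.map_mono` on `μ⌊S ≤ μ`). [cite: Balaban1987RG1, (0.4) p.253 (bookkeeping)] -/
theorem absolutelyContinuous_map_restrict_of_map {μ ν : Measure G} {f : G → G} (hf : Measurable f) (S : Set G)
    (h : μ.map f ≪ ν) : (μ.restrict S).map f ≪ ν :=
  (Measure.absolutelyContinuous_of_le (Measure.map_mono Measure.restrict_le_self hf)).trans h

end Generic

/-! ## §2  At the record: the one-variable laws of `avOfRecord F N K k` ARE absolutely continuous (the tree's exp-mean-log fibre law, every `N`), hence the per-bond inverse
LAWS follow from per-bond INVERSES alone -/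

section Record

open Literature.MathematicalPhysics.QuantumFieldTheory.Balaban1983to89
open Literature.MathematicalPhysics.QuantumFieldTheory.Balaban1983to89.T4AveragingDisintegration
open Literature.MathematicalPhysics.QuantumFieldTheory.Balaban1983to89.BlockAveragingHaarAC (centralBond centralBond_injective isLocal_avgFun)
open Literature.MathematicalPhysics.QuantumFieldTheory.Balaban1983to89.BlockAveragingEMLHaarAC (map_haar_avgFun_update_absolutelyContinuous_of_guard)
open Literature.MathematicalPhysics.QuantumFieldTheory.Balaban1983to89.BlockAveragingEMLHaarACSUN (haar_restrict_fibreGuard_map_absolutelyContinuous_of_fibreLaw)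
open Literature.MathematicalPhysics.QuantumFieldTheory.Balaban1983to89.BlockAveragingEMLFibreLawSUN (emlFibreLaw_fin)
open Literature.MathematicalPhysics.QuantumFieldTheory.Balaban1983to89.ExpMeanLog (expMeanLogSU measurable_expMeanLogSU_E)
open Summit.QuantumFields.YangMills.Theorems.BalabanUVNodesN11TransportOfRecordInPrivateCoordinateChart
open Node00 hiding SU
open T4Continuum

variable {F : T4Family} {N : ℕ} [NeZero N] {K k : ℕ}

/-- **★ THE ONE-VARIABLE LAWS OF THE AVERAGING OF RECORD ARE ABSOLUTELY CONTINUOUS** — every `N ≥ 1`, every step `k < K`, every environment `U`, every coarse bond `c`: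
`(dg).map (g ↦ Ū′(c)) ≪ dW` for `U′ = U[β(c) ↦ g]`, `Ū = (avOfRecord F N K k).avg`.  This is the tree's per-bond input of `HaarAC` for the averaging of record, BY NAME:
`BlockAveragingEMLHaarAC.map_haar_avgFun_update_absolutelyContinuous_of_guard` at the exp-mean-log fibre law on `SU(N)`
(`BlockAveragingEMLHaarACSUN.haar_restrict_fibreGuard_map_absolutelyContinuous_of_fibreLaw BlockAveragingEMLFibreLawSUN.emlFibreLaw_fin`); `avOfRecord_avg` is `rfl`.
[cite: Balaban1987RG1, (0.4) p.253 (kernel property of the tree's averaging, by name)] -/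
theorem map_haar_oneVariable_avOfRecord_absolutelyContinuous [DecidableEq (PBond (F.P K) k)] (hk : k < K)
    (U : GaugeField (F.P K) k (SU N)) (c : PBond (F.P K) (k + 1)) :
    (HaarData.haar : Measure (SU N)).map (fun g => (avOfRecord F N K k).avg (update U (centralBond c) g) c) ≪ HaarData.haar :=
  map_haar_avgFun_update_absolutelyContinuous_of_guard (succ_le_m_add_K hk) expMeanLogSU measurable_expMeanLogSU_E U c
    (haar_restrict_fibreGuard_map_absolutelyContinuous_of_fibreLaw emlFibreLaw_fin U c)

/-- The one-variable map `(U, g) ↦ Ū′(c)`, `U′ = U[β(c) ↦ g]`, of the averaging of record is JOINTLY measurable (`avOfRecord_measurable` ∘ `measurable_update'`).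
[cite: Balaban1987RG1, (0.4) p.253 (bookkeeping: measurability)] -/
theorem measurable_oneVariable_avOfRecord [DecidableEq (PBond (F.P K) k)] (c : PBond (F.P K) (k + 1)) :
    Measurable fun p : GaugeField (F.P K) k (SU N) × SU N => (avOfRecord F N K k).avg (update p.1 (centralBond c) p.2) c :=
  (measurable_pi_apply c).comp ((avOfRecord_measurable F N K k).comp measurable_update')

/-- **★★★ PER-BOND INVERSE LAWS FROM PER-BOND INVERSES ALONE, AT THE RECORD.**  For `k < K` and, per coarse bond `c` and environment `U`, a jointly measurable fine window
`Ω_c(U) ⊆ SU(N)`, a jointly measurable coarse window `T_c(U)` containing its image under `g ↦ Ū′(c)`, and a jointly measurable LEFT INVERSE `ϑ_c(U,·)` of `g ↦ Ū′(c)` on `Ω_c(U)`: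
there is a jointly measurable `jd_c(U,·) : SU(N) → ℝ≥0` with the INVERSE LAW `dg⌊Ω_c(U) = ϑ_c(U,·)_*(jd_c(U,·) · dv⌊T_c(U))` for every `c`, `U` — the `(j; hjm, hlaw)` third of the
per-bond bundle of `T4TriangularFibredChart` ∕ file 1, with NO forward Jacobian law among the hypotheses (§1 at the absolute continuity of §2).
[cite: Balaban1987RG1, (0.4) p.253 and (2.10) p.267; Balaban1988Convergent, p.267 L18–24 (bookkeeping)] -/
theorem exists_perBondInverseLaws_of_inverses [DecidableEq (PBond (F.P K) k)] (hk : k < K)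
    (Ω T : PBond (F.P K) (k + 1) → GaugeField (F.P K) k (SU N) → Set (SU N))
    (ϑ : PBond (F.P K) (k + 1) → GaugeField (F.P K) k (SU N) → SU N → SU N)
    (hΩm : ∀ c, MeasurableSet {p : GaugeField (F.P K) k (SU N) × SU N | p.2 ∈ Ω c p.1})
    (hTm : ∀ c, MeasurableSet {p : GaugeField (F.P K) k (SU N) × SU N | p.2 ∈ T c p.1})
    (hθm : ∀ c, Measurable fun p : GaugeField (F.P K) k (SU N) × SU N => ϑ c p.1 p.2)
    (hΩT : ∀ c U, MapsTo (fun g => (avOfRecord F N K k).avg (update U (centralBond c) g) c) (Ω c U) (T c U))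
    (hleft : ∀ c U, ∀ g ∈ Ω c U, ϑ c U ((avOfRecord F N K k).avg (update U (centralBond c) g) c) = g) :
    ∃ jd : PBond (F.P K) (k + 1) → GaugeField (F.P K) k (SU N) → SU N → ℝ≥0,
      (∀ c, Measurable fun p : GaugeField (F.P K) k (SU N) × SU N => jd c p.1 p.2) ∧
      (∀ c U, (HaarData.haar : Measure (SU N)).restrict (Ω c U) =
        (((HaarData.haar : Measure (SU N)).restrict (T c U)).withDensity fun v => (jd c U v : ℝ≥0∞)).map (ϑ c U)) := by
  have h : ∀ c, ∃ jd : GaugeField (F.P K) k (SU N) → SU N → ℝ≥0,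
      Measurable (fun p : GaugeField (F.P K) k (SU N) × SU N => jd p.1 p.2) ∧
      ∀ U, (HaarData.haar : Measure (SU N)).restrict (Ω c U) =
        (((HaarData.haar : Measure (SU N)).restrict (T c U)).withDensity fun v => (jd U v : ℝ≥0∞)).map fun v => ϑ c U v := by
    intro c
    have hψ : Measurable fun p : GaugeField (F.P K) k (SU N) × SU N => (avOfRecord F N K k).avg (update p.1 (centralBond c) p.2) c :=
      measurable_oneVariable_avOfRecord c
    have hT : ∀ U : GaugeField (F.P K) k (SU N), MeasurableSet (T c U) := fun U =>
      measurable_prodMk_left (m := inferInstance) (hTm c)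
    have hac : ∀ U : GaugeField (F.P K) k (SU N),
        ((HaarData.haar : Measure (SU N)).restrict (Ω c U)).map
          (fun g => (avOfRecord F N K k).avg (update U (centralBond c) g) c) ≪ HaarData.haar := fun U =>
      absolutelyContinuous_map_restrict_of_map (hψ.comp measurable_prodMk_left) (Ω c U)
        (map_haar_oneVariable_avOfRecord_absolutelyContinuous hk U c)
    exact exists_density_inverseLaw_of_absolutelyContinuous (E := GaugeField (F.P K) k (SU N)) (G := SU N)
      (HaarData.haar : Measure (SU N)) (HaarData.haar : Measure (SU N)) hψ (hΩm c) hT (hΩT c) (hθm c) (hleft c) hac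
  choose jd hjm hlaw using h
  exact ⟨jd, hjm, hlaw⟩

/-! ## §3  N11 capstone over file 1: the (B4) socket at `fieldMeasure` and `transportOfRecord =ᵐ` the private-coordinate chart integral from per-bond INVERSES (no law, no Jacobian
among the hypotheses) -/

/-- **★★★ (B4)'s CHART HALF AT `fieldMeasure` FROM PER-BOND INVERSES ALONE.**  For `k < K` and per-bond data WITHOUT ANY LAW — jointly measurable fine windows `Ω_c(U)` BLIND to
the private coordinates (`hΩbl`), jointly measurable coarse windows `T_c(U)` containing the image of `Ω_c(U)` under `g ↦ Ū′(c)` (`hΩT`), a jointly measurable two-sided inverse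
`ϑ_c(U,·)` (`hright` on `T_c(U)`, `hleft` on `Ω_c(U)`) — THERE IS a jointly measurable `jd ≥ 0` such that, with `Ψ (V,U) = extend β (c ↦ ϑ_c(U, V c)) U` and
`J (V,U) = 𝟙[∀ c, V c ∈ T_c(U)]·∏_c jd_c(U, V c)`: (i) dag-n11-d's `hpush` holds at `(dV, Kernel.const _ dU)` with charted set `{U | ∀ c, U(β c) ∈ Ω_c(U)}`; (ii) `hfib` holds;
(iii) for every `dU`-integrable measurable `ρ` with the support clause «`ρ U ≠ 0 ⇒ ∀ c, U(β c) ∈ Ω_c(U)`», `transportOfRecord F N K k ρ =ᵐ[dV] V ↦ ∫ dU J(V,U)·ρ(Ψ(V,U))`.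
Print's `∫dU δ(ŪV⁻¹)ρ(U)` ([I] (0.4), [III] (3.1)) with the δ-functions removed by solving `Ū′(c) = V(c)` bond by bond; the Jacobian is a Radon–Nikodym version.
[cite: Balaban1988Convergent, (3.1) p.264, p.267 L18–24; Balaban1987RG1, (0.4) p.253, (2.4) p.266 and (2.10) p.267] -/
theorem exists_jacobian_transportOfRecord_ae_eq_integral_privateChart [DecidableEq (PBond (F.P K) k)] (hk : k < K)
    (Ω T : PBond (F.P K) (k + 1) → GaugeField (F.P K) k (SU N) → Set (SU N))
    (ϑ : PBond (F.P K) (k + 1) → GaugeField (F.P K) k (SU N) → SU N → SU N)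
    (hΩm : ∀ c, MeasurableSet {p : GaugeField (F.P K) k (SU N) × SU N | p.2 ∈ Ω c p.1})
    (hTm : ∀ c, MeasurableSet {p : GaugeField (F.P K) k (SU N) × SU N | p.2 ∈ T c p.1})
    (hθm : ∀ c, Measurable fun p : GaugeField (F.P K) k (SU N) × SU N => ϑ c p.1 p.2)
    (hΩbl : ∀ c (U : GaugeField (F.P K) k (SU N)) (g : PBond (F.P K) (k + 1) → SU N), Ω c (extend centralBond g U) = Ω c U)
    (hΩT : ∀ c U, MapsTo (fun g => (avOfRecord F N K k).avg (update U (centralBond c) g) c) (Ω c U) (T c U))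
    (hright : ∀ c U, ∀ v ∈ T c U, (avOfRecord F N K k).avg (update U (centralBond c) (ϑ c U v)) c = v)
    (hleft : ∀ c U, ∀ g ∈ Ω c U, ϑ c U ((avOfRecord F N K k).avg (update U (centralBond c) g) c) = g) :
    ∃ jd : PBond (F.P K) (k + 1) → GaugeField (F.P K) k (SU N) → SU N → ℝ≥0,
      (∀ c, Measurable fun p : GaugeField (F.P K) k (SU N) × SU N => jd c p.1 p.2) ∧
      (((fieldMeasure (F.P K) (k + 1) (SU N)) ⊗ₘ
          (Kernel.const (GaugeField (F.P K) (k + 1) (SU N)) (fieldMeasure (F.P K) k (SU N)))).withDensity fun z =>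
            (({p : GaugeField (F.P K) (k + 1) (SU N) × GaugeField (F.P K) k (SU N) | ∀ c, p.1 c ∈ T c p.2}.indicator
              (fun p => ∏ c, jd c p.2 (p.1 c)) z : ℝ≥0) : ℝ≥0∞)).map
          (fun z : GaugeField (F.P K) (k + 1) (SU N) × GaugeField (F.P K) k (SU N) =>
            (extend centralBond (fun c => ϑ c z.2 (z.1 c)) z.2 : GaugeField (F.P K) k (SU N))) =
        (fieldMeasure (F.P K) k (SU N)).restrict {U | ∀ c, U (centralBond c) ∈ Ω c U} ∧
      (∀ᵐ z ∂(((fieldMeasure (F.P K) (k + 1) (SU N)) ⊗ₘ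
          (Kernel.const (GaugeField (F.P K) (k + 1) (SU N)) (fieldMeasure (F.P K) k (SU N)))).withDensity fun z =>
            (({p : GaugeField (F.P K) (k + 1) (SU N) × GaugeField (F.P K) k (SU N) | ∀ c, p.1 c ∈ T c p.2}.indicator
              (fun p => ∏ c, jd c p.2 (p.1 c)) z : ℝ≥0) : ℝ≥0∞)),
        (avOfRecord F N K k).avg (extend centralBond (fun c => ϑ c z.2 (z.1 c)) z.2 : GaugeField (F.P K) k (SU N)) = z.1) ∧
      (∀ {ρ : Density (F.P K) k (SU N)}, Measurable ρ → Integrable ρ (fieldMeasure (F.P K) k (SU N)) →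
        (∀ U, ρ U ≠ 0 → ∀ c, U (centralBond c) ∈ Ω c U) →
        transportOfRecord F N K k ρ =ᵐ[fieldMeasure (F.P K) (k + 1) (SU N)] fun V => ∫ U,
          (({p : GaugeField (F.P K) (k + 1) (SU N) × GaugeField (F.P K) k (SU N) | ∀ c, p.1 c ∈ T c p.2}.indicator
              (fun p => ∏ c, jd c p.2 (p.1 c)) (V, U) : ℝ≥0) : ℝ) *
            ρ (extend centralBond (fun c => ϑ c U (V c)) U : GaugeField (F.P K) k (SU N)) ∂(fieldMeasure (F.P K) k (SU N))) := by
  obtain ⟨jd, hjm, hlaw⟩ := exists_perBondInverseLaws_of_inverses hk Ω T ϑ hΩm hTm hθm hΩT hleft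
  exact ⟨jd, hjm, hpush_privateChart Ω T ϑ jd hk hΩm hTm hθm hjm hΩbl hright hlaw,
    hfib_privateChart T ϑ jd hk hTm hjm hright _,
    fun hρm hρ hS => transportOfRecord_ae_eq_integral_privateChart_of_support Ω T ϑ jd hk hΩm hTm hθm hjm hΩbl hright hlaw hρm hρ hS⟩

end Record

end Summit.QuantumFields.YangMills.Theorems.BalabanUVNodesN11PerBondInverseLawsOfRecordAC

end
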